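import Mathlib
import HarnessLib
import Summits.NavierStokesRegularity.NavierStokesRegularity.Theorems.SubOnsagerCeilingKPFluxBudget
import Summits.NavierStokesRegularity.NavierStokesRegularity.Theorems.SubOnsagerCeilingKPChainLightCone

/-!
# The ν-uniform LIGHT CONE of EVERY KP network proper: the shell amplitudes of the whole class obey the
# Katz–Pavlović causality inequality (helper file for the crux `SubOnsagerCeiling.ForwardTailCeilingKP`,
# stmt-NavierStokesRegularity-27057, `--supports`; companion of `Theorems/SubOnsagerCeilingKPChainLightCone.lean`)

The registered stubs `stub_primaryGradedLargeRatio` / `stub_primaryGradedSmallRatio` of the LEAD skeleton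
`Cruxes/ForwardTailCeilingKP/Lines/kp_shell_barrier.lean` ask for a ν-uniform super-critical barrier for EVERY KP network
proper `α ∈ E₂(R)` (symmetric (4.2), cancelling (4.3), comparable, ORTHANT, DIAGONAL feed forms).  `…KPChainLightCone.lean`
(p839054) proved the light cone of the ONE-MODE chain.  This file proves it for the WHOLE CLASS, with the single class constant
`2 = √(number of modes)`:

* `kpClass_sum_le_two_mul_sqrt` — Cauchy–Schwarz on four modes: `Σ_i x_i ≤ 2 √(Σ_i x_i² + e)` (`e ≥ 0`);
* `kpClass_shellEnergy_deriv_le` — along an honest non-negative solution, the shell energy `E_n = Σ_i ½X_{i,n}²` (`n ≥ 1`) obeys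
  `E_n' ≤ (1+ε₀)^{5(n-1)/2} · (Σ_a X_{a,n-1}²) · (Σ_i X_{i,n})` (flux identity `kpProper_shellEnergy_identity`: the out-flux and
  the dissipation are `≥ 0`, the in-flux weights are `≤ 1` by comparability);
* **`kpClass_amp_le_occupation`** — THE CLASS OCCUPATION INEQUALITY: the shell amplitude `f_n = √(Σ_i X_{i,n}²)` (`n ≥ 1`) obeys
  `f_n(t) ≤ 2 (1+ε₀)^{5(n-1)/2} ∫₀ᵗ f_{n-1}(τ)² dτ`, uniformly in `ν` — the chain's `next_le_occupation` with `c₀ = 2`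
  (square-root comparison: `g = √(f_n² + ε²)` has `g' ≤ 2Λ^{n-1} f_{n-1}²`, then `image_le_of_deriv_right_le_deriv_boundary`, `ε ↓ 0`);
* `lightCone_sq_of_occupation` — the light cone for ANY non-negative family obeying an occupation inequality
  `f_{m+1}(t) ≤ c Λ^m ∫₀ᵗ f_m²` (abstracting the induction of `…KPChainLightCone.lean`);
* **`kpClass_lightCone_sq`** — for every KP network proper, every `ε₀ > -1`, every `ν ≥ 0`: a cap `Σ_i X_{i,k}(τ)² ≤ M²` on `[0,T]`
  forces `Σ_i X_{i,k+j}(t)² ≤ ( M Λ^{-j} (K t)^{2^j − 1} )²` for every `j`, `t ∈ [0,T]`, with `K = 2 Λ^{k+1} M`, `Λ = (1+ε₀)^{5/2}`.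

So the doubly-exponentially thin precursor (pushed front) is a property of the CLASS of the crux, not of the chain alone; in
particular it applies to the 4-mode recurrent tables of census item (B) (reach pipelines, θ_f ≈ .55).
HONEST FRAMING: statements about Tao-type MODEL lattice ODEs (route SubOnsagerCeiling, rung TL-M2Break); causality bookkeeping,
not a barrier; no stub, crux or summit is proved here and nothing in this file bears on Navier–Stokes regularity.
[cite: Tao2016AveragedNS, §4 (4.2)–(4.3), (4.8), (4.13)]
-/

noncomputable section

-- the sub-problem namespace `NavierStokesRegularity.NavierStokesRegularity` is the tree's layout (D-0017)
set_option linter.dupNamespace false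

namespace Summit.NavierStokesRegularity.NavierStokesRegularity.Theorems

open Set Finset MeasureTheory intervalIntegral
open scoped Topology
open Literature.Analysis.FluidPDE.TaoCascade

variable {α : Fin 4 → Fin 4 → Fin 4 → ℤ × ℤ × ℤ → ℝ}

/-! ## §1 Algebra -/

/-- Cauchy–Schwarz on four modes with a regularising constant: `Σ_i x_i ≤ 2 √(Σ_i x_i² + e)` for `e ≥ 0`. [folklore] -/
theorem kpClass_sum_le_two_mul_sqrt (x : Fin 4 → ℝ) {e : ℝ} (he : 0 ≤ e) :
    ∑ i, x i ≤ 2 * Real.sqrt (∑ i, x i ^ 2 + e) := by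
  have hS : 0 ≤ ∑ i, x i ^ 2 + e := add_nonneg (Finset.sum_nonneg fun i _ => sq_nonneg (x i)) he
  have hsq : (∑ i, x i) ^ 2 ≤ 4 * (∑ i, x i ^ 2) := by
    simp only [Fin.sum_univ_four]
    nlinarith [sq_nonneg (x 0 - x 1), sq_nonneg (x 0 - x 2), sq_nonneg (x 0 - x 3),
      sq_nonneg (x 1 - x 2), sq_nonneg (x 1 - x 3), sq_nonneg (x 2 - x 3)]
  have hg : 0 ≤ Real.sqrt (∑ i, x i ^ 2 + e) := Real.sqrt_nonneg _
  have h2 : (∑ i, x i) ^ 2 ≤ (2 * Real.sqrt (∑ i, x i ^ 2 + e)) ^ 2 := by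
    rw [mul_pow, Real.sq_sqrt hS]
    linarith
  calc ∑ i, x i ≤ |∑ i, x i| := le_abs_self _
    _ ≤ |2 * Real.sqrt (∑ i, x i ^ 2 + e)| := sq_le_sq.mp h2
    _ = 2 * Real.sqrt (∑ i, x i ^ 2 + e) := abs_of_nonneg (by positivity)

/-! ## §2 The shell energy of a KP network proper grows at most at the rate `Λ^{n-1} F_{n-1} · Σ_i X_{i,n}` -/

/-- **Shell-energy derivative bound.** For a KP network proper (`α ∈ E₂(R)` symmetric, cancelling, comparable, orthant,
diagonal feeds), any `ν ≥ 0`, `1 + ε₀ > 0`, and a family `X` non-negative on the shells `n` and `n+1` at time `t` (`n ≥ 1`):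
`Σ_i X_{i,n}·quadTerm_i − 2ν(1+ε₀)^{2n} Σ_i ½X_{i,n}² ≤ (1+ε₀)^{5(n-1)/2} (Σ_a X_{a,n-1}²)(Σ_i X_{i,n})`
(the left side is the derivative of `Σ_i ½X_{i,n}²` along the viscous lattice). MODEL lattice statement.
[cite: Tao2016AveragedNS, §4 (4.8), (4.13)] -/
theorem kpClass_shellEnergy_deriv_le {R : ℝ} (hT : InTableClass R α)
    (hO : ∀ (Y : Fin 4 → ℤ → ℝ → ℝ) (τ : ℝ), (∀ (j : Fin 4) (k : ℤ), 1 ≤ k → 0 ≤ Y j k τ) →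
      ∀ δ : ℝ, 0 < δ → ∀ (i : Fin 4) (n : ℤ), 1 ≤ n → Y i n τ = 0 → 0 ≤ quadTerm δ α Y i n τ)
    (hD : ∀ a b i : Fin 4, a ≠ b → α a b i (0, 0, 1) = 0)
    {ε₀ ν : ℝ} (hε : -1 < ε₀) (hν : 0 ≤ ν) (X : Fin 4 → ℤ → ℝ → ℝ) (n : ℤ) (t : ℝ)
    (hXn : ∀ i, 0 ≤ X i n t) (hXn1 : ∀ j, 0 ≤ X j (n + 1) t) :
    ∑ i, X i n t * quadTerm ε₀ α X i n t - 2 * (ν * (1 + ε₀) ^ ((2 : ℝ) * n)) * ∑ i, (1 / 2 : ℝ) * X i n t ^ 2 ≤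
      (1 + ε₀) ^ ((5 : ℝ) * ((n : ℝ) - 1) / 2) * (∑ a, X a (n - 1) t ^ 2) * (∑ i, X i n t) := by
  obtain ⟨hs, hc, hcmp⟩ := hT
  have hb : 0 < 1 + ε₀ := by linarith
  rw [kpProper_shellEnergy_identity hs hc hO hD ε₀ X n t]
  -- the in-flux weights are `≤ 1`
  have hIN : ∑ i, ∑ a, α a a i (0, 0, 1) * X a (n - 1) t ^ 2 * X i n t ≤
      (∑ a, X a (n - 1) t ^ 2) * (∑ i, X i n t) := by
    rw [Finset.sum_mul_sum, Finset.sum_comm]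
    refine Finset.sum_le_sum fun i _ => Finset.sum_le_sum fun a _ => ?_
    have hw : α i i a (0, 0, 1) ≤ 1 := (abs_le.mp (hcmp i i a _ kpProper_mem001).1).2
    have hx : 0 ≤ X i (n - 1) t ^ 2 * X a n t := mul_nonneg (sq_nonneg _) (hXn a)
    nlinarith
  -- the out-flux is `≥ 0`
  have hOUT : 0 ≤ ∑ i, ∑ j, α i i j (0, 0, 1) * X i n t ^ 2 * X j (n + 1) t :=
    Finset.sum_nonneg fun i _ => Finset.sum_nonneg fun j _ =>
      mul_nonneg (mul_nonneg (kpProper_feed_nonneg hO i j) (sq_nonneg _)) (hXn1 j)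
  -- the dissipation is `≥ 0`
  have hDISS : 0 ≤ 2 * (ν * (1 + ε₀) ^ ((2 : ℝ) * n)) * ∑ i, (1 / 2 : ℝ) * X i n t ^ 2 := by
    have h1 : 0 ≤ ν * (1 + ε₀) ^ ((2 : ℝ) * n) := mul_nonneg hν (Real.rpow_pos_of_pos hb _).le
    have h2 : 0 ≤ ∑ i, (1 / 2 : ℝ) * X i n t ^ 2 := Finset.sum_nonneg fun i _ => by positivity
    positivity
  have hL1 : 0 ≤ (1 + ε₀) ^ ((5 : ℝ) * ((n : ℝ) - 1) / 2) := (Real.rpow_pos_of_pos hb _).le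
  have hL0 : 0 ≤ (1 + ε₀) ^ ((5 : ℝ) * n / 2) := (Real.rpow_pos_of_pos hb _).le
  have hA := mul_le_mul_of_nonneg_left hIN hL1
  have hB := mul_nonneg hL0 hOUT
  nlinarith

/-! ## §3 The class occupation inequality (square-root comparison) -/

/-- **THE CLASS OCCUPATION INEQUALITY.** For a KP network proper, along an honest `ν`-viscous solution (`ν ≥ 0`,
`1 + ε₀ > 0`) from a one-shell datum on shell `0`, continuous, non-negative on the shells `≥ 1`, the amplitude of every shell
`n ≥ 1` is bounded by the occupation of the previous one:
`√(Σ_i X_{i,n}(t)²) ≤ 2 (1+ε₀)^{5(n-1)/2} ∫₀ᵗ Σ_a X_{a,n-1}(τ)² dτ` for `t ∈ [0,s]` — the chain's `next_le_occupation` with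
`c₀ = 2`, uniformly in `ν`. MODEL lattice statement. [cite: Tao2016AveragedNS, §4 (4.8), (4.13)] -/
theorem kpClass_amp_le_occupation {R : ℝ} (hT : InTableClass R α)
    (hO : ∀ (Y : Fin 4 → ℤ → ℝ → ℝ) (τ : ℝ), (∀ (j : Fin 4) (k : ℤ), 1 ≤ k → 0 ≤ Y j k τ) →
      ∀ δ : ℝ, 0 < δ → ∀ (i : Fin 4) (n : ℤ), 1 ≤ n → Y i n τ = 0 → 0 ≤ quadTerm δ α Y i n τ)
    (hD : ∀ a b i : Fin 4, a ≠ b → α a b i (0, 0, 1) = 0)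
    {ε₀ ν s : ℝ} (hε : -1 < ε₀) (hν : 0 ≤ ν) {X₀ : Fin 4 → ℝ} {X : Fin 4 → ℤ → ℝ → ℝ}
    (hdat : ∀ (i : Fin 4) (k : ℤ), X i k 0 = if k = 0 then X₀ i else 0)
    (hXc : ∀ (i : Fin 4) (k : ℤ), Continuous (X i k))
    (hode : ∀ (i : Fin 4) (k : ℤ), ∀ t ∈ Icc (0 : ℝ) s, HasDerivWithinAt (X i k)
      (quadTerm ε₀ α X i k t - ν * (1 + ε₀) ^ ((2 : ℝ) * k) * X i k t) (Icc (0 : ℝ) s) t)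
    (hXpos : ∀ t ∈ Icc (0 : ℝ) s, ∀ (i : Fin 4) (k : ℤ), 1 ≤ k → 0 ≤ X i k t)
    (n : ℤ) (hn : 1 ≤ n) :
    ∀ t ∈ Icc (0 : ℝ) s, Real.sqrt (∑ i, X i n t ^ 2) ≤
      2 * (1 + ε₀) ^ ((5 : ℝ) * ((n : ℝ) - 1) / 2) * ∫ τ in (0 : ℝ)..t, ∑ a, X a (n - 1) τ ^ 2 := by
  intro t ht
  have hb : 0 < 1 + ε₀ := by linarith
  set L : ℝ := (1 + ε₀) ^ ((5 : ℝ) * ((n : ℝ) - 1) / 2) with hL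
  have hL0 : 0 < L := Real.rpow_pos_of_pos hb _
  -- the previous shell's squared amplitude
  set F : ℝ → ℝ := fun τ => ∑ a, X a (n - 1) τ ^ 2 with hF
  have hFc : Continuous F := continuous_finsetSum _ fun a _ => (hXc a (n - 1)).pow 2
  have hF0 : ∀ τ, 0 ≤ F τ := fun τ => Finset.sum_nonneg fun a _ => sq_nonneg _
  -- the shell energy, its derivative within `[0,s]` and the derivative bound of §2
  set E : ℝ → ℝ := fun τ => ∑ i, (1 / 2 : ℝ) * X i n τ ^ 2 with hE
  have hE2 : ∀ τ, 2 * E τ = ∑ i, X i n τ ^ 2 := by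
    intro τ
    simp only [hE, Finset.mul_sum]
    exact Finset.sum_congr rfl fun i _ => by ring
  set D : ℝ → ℝ := fun τ => ∑ i, X i n τ * quadTerm ε₀ α X i n τ -
    2 * (ν * (1 + ε₀) ^ ((2 : ℝ) * n)) * ∑ i, (1 / 2 : ℝ) * X i n τ ^ 2 with hDdef
  have hEd : ∀ τ ∈ Icc (0 : ℝ) s, HasDerivWithinAt E (D τ) (Icc 0 s) τ := fun τ hτ =>
    forwardSourceSmoothing_hasDerivWithinAt_denergy Finset.univ n (fun i => hode i n) hτ
  have hDle : ∀ τ ∈ Icc (0 : ℝ) s, D τ ≤ L * F τ * ∑ i, X i n τ := fun τ hτ =>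
    kpClass_shellEnergy_deriv_le hT hO hD hε hν X n τ (fun i => hXpos τ hτ i n hn)
      (fun j => hXpos τ hτ j (n + 1) (by omega))
  -- it suffices to prove the bound up to every `ε > 0`
  refine le_of_forall_pos_le_add fun ε hεp => ?_
  have hpos : ∀ τ, 0 < 2 * E τ + ε ^ 2 := fun τ => by
    have : 0 ≤ 2 * E τ := by rw [hE2]; exact Finset.sum_nonneg fun i _ => sq_nonneg _
    positivity
  -- the regularised amplitude `g = √(2E + ε²)` and its derivative within `[0,s]`
  set g : ℝ → ℝ := fun τ => Real.sqrt (2 * E τ + ε ^ 2) with hg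
  have hgd : ∀ τ ∈ Icc (0 : ℝ) s,
      HasDerivWithinAt g ((2 * D τ) / (2 * Real.sqrt (2 * E τ + ε ^ 2))) (Icc 0 s) τ := by
    intro τ hτ
    have h1 := ((hEd τ hτ).const_mul (2 : ℝ)).add_const (ε ^ 2)
    exact h1.sqrt (ne_of_gt (hpos τ))
  have hgc : ContinuousOn g (Icc 0 s) := by
    have hEc : Continuous E := forwardSourceSmoothing_continuous_denergy Finset.univ n (fun i => hXc i n)
    exact ((continuous_const.mul hEc).add continuous_const).sqrt.continuousOn
  -- the boundary function `B = ε + 2L ∫ F`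
  set B : ℝ → ℝ := fun τ => ε + 2 * L * ∫ θ in (0 : ℝ)..τ, F θ with hB
  have hBd : ∀ τ, HasDerivAt B (2 * L * F τ) τ := fun τ =>
    ((hFc.integral_hasStrictDerivAt 0 τ).hasDerivAt.const_mul (2 * L)).const_add ε
  have hBc : ContinuousOn B (Icc 0 s) := fun τ _ => (hBd τ).continuousAt.continuousWithinAt
  -- at time `0`: `g 0 = ε = B 0`
  have h0 : g 0 ≤ B 0 := by
    have hX0 : ∀ i, X i n 0 = 0 := fun i => by rw [hdat]; exact if_neg (by omega)
    have hE0 : E 0 = 0 := by simp [hE, hX0]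
    have hg0 : g 0 = ε := by
      simp only [hg, hE0, mul_zero, zero_add]
      exact Real.sqrt_sq hεp.le
    have hB0 : B 0 = ε := by simp [hB]
    rw [hg0, hB0]
  -- the derivative bound `g' ≤ B'`
  have hbound : ∀ τ ∈ Ico (0 : ℝ) s, (2 * D τ) / (2 * Real.sqrt (2 * E τ + ε ^ 2)) ≤ 2 * L * F τ := by
    intro τ hτ
    have hτ' : τ ∈ Icc (0 : ℝ) s := Ico_subset_Icc_self hτ
    have hsq : 0 < Real.sqrt (2 * E τ + ε ^ 2) := Real.sqrt_pos.2 (hpos τ)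
    rw [div_le_iff₀ (by positivity)]
    have hsum : ∑ i, X i n τ ≤ 2 * Real.sqrt (2 * E τ + ε ^ 2) := by
      have := kpClass_sum_le_two_mul_sqrt (fun i => X i n τ) (sq_nonneg ε)
      rw [hE2 τ]
      simpa using this
    have hLF : 0 ≤ L * F τ := mul_nonneg hL0.le (hF0 τ)
    have h3 := mul_le_mul_of_nonneg_left hsum hLF
    have hd := hDle τ hτ'
    nlinarith
  -- comparison on `[0, s]`
  have hcomp := image_le_of_deriv_right_le_deriv_boundary hgc
    (fun τ hτ => (hgd τ (Ico_subset_Icc_self hτ)).mono_of_mem_nhdsWithin (Icc_mem_nhdsGE_of_mem hτ))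
    h0 hBc (fun τ _ => (hBd τ).hasDerivWithinAt) hbound
  have h1 : Real.sqrt (∑ i, X i n t ^ 2) ≤ g t := by
    simp only [hg]
    exact Real.sqrt_le_sqrt (by rw [hE2]; linarith [sq_nonneg ε])
  have h2 : g t ≤ B t := hcomp ht
  have h3 : B t = ε + 2 * L * ∫ θ in (0 : ℝ)..t, F θ := rfl
  linarith

/-! ## §4 The light cone of any non-negative family obeying an occupation inequality -/

/-- **Abstract light cone.** Let `f_m : [0,s] → ℝ` (`m ≥ 0`) be continuous, non-negative for `m ≥ 1`, and obey the occupation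
inequality `f_{m+1}(t) ≤ c b^{5m/2} ∫₀ᵗ f_m²` (`c ≥ 0`, `b > 0`).  If `f_k(τ)² ≤ M²` on `[0,T]` (`T ≤ s`), then for every
`j ≥ 0` and `t ∈ [0,T]`: `f_{k+j}(t)² ≤ ( M b^{-5j/2} (K t)^{2^j − 1} )²`, `K = c b^{5(k+1)/2} M` (the induction of
`KPChainLightCone.lightCone_sq`, with the chain's `next_le_occupation` replaced by the hypothesis). [this file] -/
theorem lightCone_sq_of_occupation {c b s : ℝ} (hb : 0 < b) (hc : 0 ≤ c) {f : ℕ → ℝ → ℝ}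
    (hcont : ∀ m : ℕ, ContinuousOn (f m) (Icc 0 s))
    (hnn : ∀ m : ℕ, ∀ t ∈ Icc (0 : ℝ) s, 0 ≤ f (m + 1) t)
    (hocc : ∀ m : ℕ, ∀ t ∈ Icc (0 : ℝ) s,
      f (m + 1) t ≤ c * b ^ ((5 : ℝ) * (m : ℝ) / 2) * ∫ τ in (0 : ℝ)..t, f m τ ^ 2)
    (k : ℕ) {M T : ℝ} (hT : T ∈ Icc (0 : ℝ) s)
    (hcap : ∀ τ ∈ Icc (0 : ℝ) T, f k τ ^ 2 ≤ M ^ 2) :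
    ∀ j : ℕ, ∀ t ∈ Icc (0 : ℝ) T, f (k + j) t ^ 2 ≤
      (M * b ^ (-((5 : ℝ) * (j : ℝ) / 2)) *
        (c * b ^ ((5 : ℝ) * ((k : ℝ) + 1) / 2) * M * t) ^ (2 ^ j - 1)) ^ 2 := by
  intro j
  induction j with
  | zero =>
    intro t ht
    have h0 : b ^ (-((5 : ℝ) * ((0 : ℕ) : ℝ) / 2)) = 1 := by
      rw [Nat.cast_zero, mul_zero, zero_div, neg_zero, Real.rpow_zero]
    rw [h0]
    simpa using hcap t ht
  | succ j ih =>
    intro t ht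
    set n : ℕ := 2 ^ j - 1 with hn
    set Bj : ℝ := b ^ (-((5 : ℝ) * (j : ℝ) / 2)) with hBj
    set K : ℝ := c * b ^ ((5 : ℝ) * ((k : ℝ) + 1) / 2) * M with hK
    have hts : t ∈ Icc (0 : ℝ) s := ⟨ht.1, ht.2.trans hT.2⟩
    -- the inductive bound as `(C τ^n)²` and the integral of the even power
    have hcapj : ∀ τ ∈ Icc (0 : ℝ) t, f (k + j) τ ^ 2 ≤ ((M * Bj * K ^ n) * τ ^ n) ^ 2 := by
      intro τ hτ
      calc f (k + j) τ ^ 2 ≤ (M * Bj * (K * τ) ^ n) ^ 2 := ih τ ⟨hτ.1, hτ.2.trans ht.2⟩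
        _ = ((M * Bj * K ^ n) * τ ^ n) ^ 2 := by ring
    have hI := KPChainLightCone.integral_sq_le_of_sq_le_pow ht.1
      ((hcont (k + j)).mono (Icc_subset_Icc le_rfl hts.2)) hcapj
    -- one causality step
    have hB0 : 0 ≤ c * b ^ ((5 : ℝ) * (((k + j : ℕ)) : ℝ) / 2) := mul_nonneg hc (Real.rpow_pos_of_pos hb _).le
    have hstep : f (k + j + 1) t ≤
        c * b ^ ((5 : ℝ) * (((k + j : ℕ)) : ℝ) / 2) * ((M * Bj * K ^ n) ^ 2 * t ^ (2 * n + 1)) :=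
      (hocc (k + j) t hts).trans (mul_le_mul_of_nonneg_left hI hB0)
    -- the exponents close exactly
    have hexp : b ^ ((5 : ℝ) * (((k + j : ℕ)) : ℝ) / 2) * (Bj * Bj) =
        b ^ (-((5 : ℝ) * (((j + 1 : ℕ)) : ℝ) / 2)) * b ^ ((5 : ℝ) * ((k : ℝ) + 1) / 2) := by
      rw [hBj, ← Real.rpow_add hb, ← Real.rpow_add hb, ← Real.rpow_add hb]
      congr 1
      push_cast
      ring
    have hval : c * b ^ ((5 : ℝ) * (((k + j : ℕ)) : ℝ) / 2) * ((M * Bj * K ^ n) ^ 2 * t ^ (2 * n + 1)) =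
        M * b ^ (-((5 : ℝ) * (((j + 1 : ℕ)) : ℝ) / 2)) * (K * t) ^ (2 * n + 1) := by
      rw [hK]
      linear_combination (c * M ^ 2 * (c * b ^ ((5 : ℝ) * ((k : ℝ) + 1) / 2) * M) ^ (2 * n) *
        t ^ (2 * n + 1)) * hexp
    have hle : f (k + j + 1) t ≤ M * b ^ (-((5 : ℝ) * (((j + 1 : ℕ)) : ℝ) / 2)) * (K * t) ^ (2 * n + 1) := by
      rw [← hval]; exact hstep
    have hz : 0 ≤ f (k + j + 1) t := hnn (k + j) t hts
    rw [show k + (j + 1) = k + j + 1 from by ring, KPChainLightCone.two_pow_succ_sub_one, ← hn]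
    exact pow_le_pow_left₀ hz hle 2

/-! ## §5 The light cone of every KP network proper -/

/-- **THE LIGHT CONE OF A KP NETWORK PROPER** (every `α ∈ E₂(R)` symmetric, cancelling, comparable, orthant, diagonal feeds;
every `ε₀ > -1`, every `ν ≥ 0`, every window): along an honest solution from a one-shell datum on shell `0`, continuous,
non-negative on the shells `≥ 1`, a cap on ONE shell `Σ_i X_{i,k}(τ)² ≤ M²` on `[0,T]` (`T ≤ s`) forces, for every
`j ≥ 0` and `t ∈ [0,T]`,
`Σ_i X_{i,k+j}(t)² ≤ ( M (1+ε₀)^{-5j/2} (K t)^{2^j − 1} )²`, `K = 2 (1+ε₀)^{5(k+1)/2} M`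
— the shells ahead of a capped shell are dark up to a doubly-exponentially small precursor before the turnover time `1/K`,
uniformly in the viscosity, for the WHOLE class of the crux (class constant `2 = √4`). MODEL lattice statement.
[cite: Tao2016AveragedNS, §4 (4.2)–(4.3), (4.8), (4.13)] -/
theorem kpClass_lightCone_sq {R : ℝ} (hT : InTableClass R α)
    (hO : ∀ (Y : Fin 4 → ℤ → ℝ → ℝ) (τ : ℝ), (∀ (j : Fin 4) (k : ℤ), 1 ≤ k → 0 ≤ Y j k τ) →
      ∀ δ : ℝ, 0 < δ → ∀ (i : Fin 4) (n : ℤ), 1 ≤ n → Y i n τ = 0 → 0 ≤ quadTerm δ α Y i n τ)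
    (hD : ∀ a b i : Fin 4, a ≠ b → α a b i (0, 0, 1) = 0)
    {ε₀ ν s : ℝ} (hε : -1 < ε₀) (hν : 0 ≤ ν) {X₀ : Fin 4 → ℝ} {X : Fin 4 → ℤ → ℝ → ℝ}
    (hdat : ∀ (i : Fin 4) (k : ℤ), X i k 0 = if k = 0 then X₀ i else 0)
    (hXc : ∀ (i : Fin 4) (k : ℤ), Continuous (X i k))
    (hode : ∀ (i : Fin 4) (k : ℤ), ∀ t ∈ Icc (0 : ℝ) s, HasDerivWithinAt (X i k)
      (quadTerm ε₀ α X i k t - ν * (1 + ε₀) ^ ((2 : ℝ) * k) * X i k t) (Icc (0 : ℝ) s) t)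
    (hXpos : ∀ t ∈ Icc (0 : ℝ) s, ∀ (i : Fin 4) (k : ℤ), 1 ≤ k → 0 ≤ X i k t)
    (k : ℕ) {M T : ℝ} (hTs : T ∈ Icc (0 : ℝ) s)
    (hcap : ∀ τ ∈ Icc (0 : ℝ) T, ∑ i, X i (k : ℤ) τ ^ 2 ≤ M ^ 2) :
    ∀ j : ℕ, ∀ t ∈ Icc (0 : ℝ) T, ∑ i, X i ((k + j : ℕ) : ℤ) t ^ 2 ≤
      (M * (1 + ε₀) ^ (-((5 : ℝ) * (j : ℝ) / 2)) *
        (2 * (1 + ε₀) ^ ((5 : ℝ) * ((k : ℝ) + 1) / 2) * M * t) ^ (2 ^ j - 1)) ^ 2 := by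
  have hb : 0 < 1 + ε₀ := by linarith
  -- the shell amplitudes
  set f : ℕ → ℝ → ℝ := fun m τ => Real.sqrt (∑ i, X i (m : ℤ) τ ^ 2) with hf
  have hS0 : ∀ (m : ℕ) (τ : ℝ), 0 ≤ ∑ i, X i (m : ℤ) τ ^ 2 := fun m τ => Finset.sum_nonneg fun i _ => sq_nonneg _
  have hf2 : ∀ (m : ℕ) (τ : ℝ), f m τ ^ 2 = ∑ i, X i (m : ℤ) τ ^ 2 := fun m τ => Real.sq_sqrt (hS0 m τ)
  have hcont : ∀ m : ℕ, ContinuousOn (f m) (Icc 0 s) := fun m =>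
    (continuous_finsetSum _ fun i _ => (hXc i (m : ℤ)).pow 2).sqrt.continuousOn
  have hnn : ∀ m : ℕ, ∀ t ∈ Icc (0 : ℝ) s, 0 ≤ f (m + 1) t := fun m t _ => Real.sqrt_nonneg _
  have hocc : ∀ m : ℕ, ∀ t ∈ Icc (0 : ℝ) s,
      f (m + 1) t ≤ 2 * (1 + ε₀) ^ ((5 : ℝ) * (m : ℝ) / 2) * ∫ τ in (0 : ℝ)..t, f m τ ^ 2 := by
    intro m t ht
    have h := kpClass_amp_le_occupation hT hO hD hε hν hdat hXc hode hXpos ((m : ℤ) + 1) (by omega) t ht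
    have e1 : (5 : ℝ) * ((((m : ℤ) + 1 : ℤ) : ℝ) - 1) / 2 = (5 : ℝ) * (m : ℝ) / 2 := by push_cast; ring
    have e2 : (m : ℤ) + 1 - 1 = (m : ℤ) := by ring
    have e3 : (((m + 1 : ℕ)) : ℤ) = (m : ℤ) + 1 := by push_cast; ring
    rw [e1, e2] at h
    have hint : (∫ τ in (0 : ℝ)..t, f m τ ^ 2) = ∫ τ in (0 : ℝ)..t, ∑ a, X a (m : ℤ) τ ^ 2 :=
      intervalIntegral.integral_congr fun τ _ => hf2 m τ
    rw [hint]
    show Real.sqrt (∑ i, X i (((m + 1 : ℕ)) : ℤ) t ^ 2) ≤ _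
    rw [e3]
    exact h
  have hcap' : ∀ τ ∈ Icc (0 : ℝ) T, f k τ ^ 2 ≤ M ^ 2 := fun τ hτ => by rw [hf2]; exact hcap τ hτ
  intro j t ht
  have h := lightCone_sq_of_occupation hb (by norm_num : (0 : ℝ) ≤ 2) hcont hnn hocc k hTs hcap' j t ht
  rw [hf2] at h
  exact h

end Summit.NavierStokesRegularity.NavierStokesRegularity.Theorems

end
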